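import Literature.NumberTheory.Rogawski1990.SingularSemisimpleFrame
import Literature.NumberTheory.Rogawski1990.LocalTransfer
import HarnessLib

/-!
# Singular semisimple elements of a unitary group in three variables, II: the eigenvalue pair `{α, α, β}` and the frame of a
# semisimple, non-regular, non-central `γ ∈ U(H)` (Rogawski 1990, §3.8, Prop. 3.8.1 (a))

Topic `NumberTheory/Rogawski1990`; namespace `Literature.NumberTheory.Rogawski1990`.  THEOREMS ONLY (no definition, no instance, no named
fact, no `sorry`).  Sequel of `SingularSemisimpleFrame` (the frame given the eigenvalue pair).

* §1 `exists_eigenpair_of_isSemisimple_of_not_separable` — SPECTRAL SHAPE (any perfect field `K`): if the endomorphism of `K³` given by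
  `M ∈ M₃(K)` is semisimple, its characteristic polynomial is NOT separable (¬ ★ `IsRegularElt`) and `M` is not scalar (not central), then
  there are `α ≠ β` in `K` with `(M − α)(M − β) = 0`, `M ≠ α`, `M ≠ β` — eigenvalues `{α, α, β}` [Rogawski1990, §3.8]: the minimal polynomial
  is squarefree (semisimplicity), hence is not the inseparable cubic characteristic polynomial it divides, and is not linear (non-scalar),
  so it is quadratic with the RATIONAL root of its linear cofactor in the characteristic polynomial — `μ = (X − α)(X − β)`.
* §2 **`exists_singular_frame_of_isSemisimpleElt`** — for `γ ∈ U_σ(H)(K)` semisimple (★ `IsSemisimpleElt`), not regular, not scalar: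
  `a ≠ b` with `σ(a)a = σ(b)b = 1`, `P ∈ GL₃(K)`, hermitian non-degenerate `H_a ∈ M₂(K)`, `H_b ∈ M₁(K)` with `ᵗ(σP) H P = H_a ⊕ᶠ H_b`,
  `γ P = P (a·1₂ ⊕ᶠ b·1₁)` (★ `exists_singular_frame`); **`exists_singular_frame_of_anisotropic`** — for ANISOTROPIC `H` every element is
  semisimple (★ `isSemisimpleElt_of_anisotropic`), so only «not regular, not scalar» is asked: the singular classes of the anisotropic `G′`.

## References
* J. Rogawski, *Automorphic Representations of Unitary Groups in Three Variables*, Ann. of Math. Stud. 123 (1990), §3.8 «Singular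
  semisimple elements», Prop. 3.8.1 (a) p. 27; §3.1 p. 19 [Rogawski1990].
-/

noncomputable section

namespace Literature.NumberTheory.Rogawski1990

open scoped MatrixGroups
open Matrix Polynomial Module
open Literature.AlgebraicGeometry.ShimuraVarieties (unitaryGroup mem_unitaryGroup_iff hermForm)
open Literature.NumberTheory.Automorphic.UnitaryGroup (finSum)

/-! ## §1 The spectral shape of a singular, non-central, semisimple `3 × 3` matrix -/

section Spectral

variable {K : Type*} [Field K] [PerfectField K]

/-- **Eigenvalues `{α, α, β}`**: if `M ∈ M₃(K)` (`K` perfect) acts semisimply on `K³`, its characteristic polynomial is not separable and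
`M` is not a scalar, then there are `α ≠ β ∈ K` with `(M − α)(M − β) = 0`, `M ≠ α · 1`, `M ≠ β · 1`: the minimal polynomial is squarefree
(semisimplicity), hence ≠ the inseparable cubic characteristic polynomial it divides, and of degree ≠ 1 (non-scalar), so of degree `2` with
the rational root of the linear cofactor — `μ = (X − α)(X − β)`. [cite: Rogawski1990, §3.8 Prop. 3.8.1 p. 27] -/
theorem exists_eigenpair_of_isSemisimple_of_not_separable (M : Matrix (Fin 3) (Fin 3) K)
    (hss : Module.End.IsSemisimple (Matrix.toLin' M)) (hsep : ¬ M.charpoly.Separable) (hnsc : ∀ ζ : K, M ≠ ζ • (1 : Matrix (Fin 3) (Fin 3) K)) :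
    ∃ α β : K, α ≠ β ∧ (M - α • 1) * (M - β • 1) = 0 ∧ M ≠ α • 1 ∧ M ≠ β • 1 := by
  classical
  set μ : K[X] := minpoly K M with hμdef
  have hint : IsIntegral K M := Matrix.isIntegral M
  have hμmonic : μ.Monic := minpoly.monic hint
  have hsq : Squarefree μ := by
    have h := hss.minpoly_squarefree
    rwa [Matrix.minpoly_toLin'] at h
  have hdvd : μ ∣ M.charpoly := Matrix.minpoly_dvd_charpoly M
  have hcmonic : M.charpoly.Monic := Matrix.charpoly_monic M
  have hcdeg : M.charpoly.natDegree = 3 := by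
    rw [Matrix.charpoly_natDegree_eq_dim, Fintype.card_fin]
  have hμpos : 0 < μ.natDegree := minpoly.natDegree_pos hint
  have hμle : μ.natDegree ≤ 3 := hcdeg ▸ Polynomial.natDegree_le_of_dvd hdvd hcmonic.ne_zero
  have hμaeval : Polynomial.aeval M μ = 0 := minpoly.aeval K M
  -- degree 3 is excluded: `μ = charpoly` would be squarefree, hence separable
  have hne3 : μ.natDegree ≠ 3 := by
    intro h3
    have heq : M.charpoly = μ := Polynomial.eq_of_monic_of_dvd_of_natDegree_le hμmonic hcmonic hdvd (by rw [hcdeg, h3])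
    exact hsep (heq ▸ PerfectField.separable_iff_squarefree.2 hsq)
  -- degree 1 is excluded: `M` would be a scalar
  have hne1 : μ.natDegree ≠ 1 := by
    intro h1
    have hμ1 : μ = X + C (μ.coeff 0) := hμmonic.eq_X_add_C h1
    have h0 : M + (μ.coeff 0) • (1 : Matrix (Fin 3) (Fin 3) K) = 0 := by
      have h := hμaeval
      rw [hμ1, map_add, Polynomial.aeval_X, Polynomial.aeval_C, Algebra.algebraMap_eq_smul_one] at h
      exact h
    exact hnsc (-μ.coeff 0) (by rw [neg_smul]; exact eq_neg_of_add_eq_zero_left h0)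
  have h2 : μ.natDegree = 2 := by omega
  -- the linear cofactor of `μ` in the characteristic polynomial gives a rational root `r`
  set q : K[X] := M.charpoly /ₘ μ with hqdef
  have hcq : M.charpoly = μ * q := by
    have h := Polynomial.modByMonic_add_div M.charpoly μ
    rw [(Polynomial.modByMonic_eq_zero_iff_dvd hμmonic).2 hdvd, zero_add] at h
    exact h.symm
  have hqmonic : q.Monic := by
    have h := hcmonic
    rw [hcq] at h
    exact hμmonic.of_mul_monic_left h
  have hqdeg : q.natDegree = 1 := by
    have h := congrArg Polynomial.natDegree hcq
    rw [hcdeg, hμmonic.natDegree_mul hqmonic, h2] at h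
    omega
  set r : K := -q.coeff 0 with hrdef
  have hq1 : q = X - C r := by
    rw [hqmonic.eq_X_add_C hqdeg, hrdef, map_neg, sub_neg_eq_add]
  have hrootc : M.charpoly.IsRoot r := by
    rw [hcq, hq1, Polynomial.IsRoot, Polynomial.eval_mul, Polynomial.eval_sub, Polynomial.eval_X, Polynomial.eval_C, sub_self,
      mul_zero]
  -- a root of the characteristic polynomial is a root of the minimal polynomial
  have hrootμ : μ.IsRoot r := by
    have h1 : (Matrix.toLin' M).charpoly.IsRoot r := by rwa [Matrix.charpoly_toLin']
    have h2' : Module.End.HasEigenvalue (Matrix.toLin' M) r := (Module.End.hasEigenvalue_iff_isRoot_charpoly _ _).2 h1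
    have h3 := Module.End.hasEigenvalue_iff_isRoot.1 h2'
    rwa [Matrix.minpoly_toLin'] at h3
  -- `μ = (X − r)(X − s)`
  set q' : K[X] := μ /ₘ (X - C r) with hq'def
  have hμq' : μ = (X - C r) * q' := (Polynomial.mul_divByMonic_eq_iff_isRoot.2 hrootμ).symm
  have hq'monic : q'.Monic := by
    have h := hμmonic
    rw [hμq'] at h
    exact (Polynomial.monic_X_sub_C r).of_mul_monic_left h
  have hq'deg : q'.natDegree = 1 := by
    have h := congrArg Polynomial.natDegree hμq'
    rw [h2, (Polynomial.monic_X_sub_C r).natDegree_mul hq'monic, Polynomial.natDegree_X_sub_C] at h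
    omega
  set s : K := -q'.coeff 0 with hsdef
  have hq'1 : q' = X - C s := by
    rw [hq'monic.eq_X_add_C hq'deg, hsdef, map_neg, sub_neg_eq_add]
  have hμrs : μ = (X - C r) * (X - C s) := by rw [hμq', hq'1]
  have hrs : r ≠ s := by
    intro hrs
    rw [← hrs] at hμrs
    have hunit := hsq (X - C r) ⟨1, by rw [mul_one, ← hμrs]⟩
    exact Polynomial.not_isUnit_X_sub_C r hunit
  refine ⟨r, s, hrs, ?_, fun h => hnsc r h, fun h => hnsc s h⟩
  have h := hμaeval
  rw [hμrs, map_mul, map_sub, map_sub, Polynomial.aeval_X, Polynomial.aeval_C, Polynomial.aeval_C,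
    Algebra.algebraMap_eq_smul_one, Algebra.algebraMap_eq_smul_one] at h
  exact h

end Spectral

/-! ## §2 For `γ ∈ U(H)(K)` semisimple, not regular, not scalar — and for anisotropic `H` -/

section Unitary

variable {K : Type*} [Field K] [PerfectField K] (σ : K →+* K)

/-- **Frame of a singular, non-central, semisimple element of `U_σ(H)(K)`** (`K` perfect, `σ` an involution, `H ∈ M₃(K)` hermitian
non-degenerate): if `γ` is semisimple (★ `IsSemisimpleElt`), NOT regular (¬ ★ `IsRegularElt`: inseparable characteristic polynomial) and
NOT a scalar, then there are `a ≠ b` with `σ(a)a = σ(b)b = 1`, `P ∈ GL₃(K)` and hermitian non-degenerate `H_a ∈ M₂(K)`, `H_b ∈ M₁(K)`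
with `ᵗ(σP) H P = H_a ⊕ᶠ H_b` and `γ P = P (a·1₂ ⊕ᶠ b·1₁)`. [cite: Rogawski1990, §3.8 Prop. 3.8.1 p. 27] -/
theorem exists_singular_frame_of_isSemisimpleElt (hσ : ∀ x, σ (σ x) = x) (H : Matrix (Fin 3) (Fin 3) K) (hH : (H.map σ)ᵀ = H)
    (hdet : H.det ≠ 0)
    (γ : unitaryGroup σ H) (hss : IsSemisimpleElt σ H γ) (hnreg : ¬ IsRegularElt (γ : GL (Fin 3) K))
    (hnsc : ∀ ζ : K, ((γ : GL (Fin 3) K) : Matrix (Fin 3) (Fin 3) K) ≠ ζ • 1) :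
    ∃ (a b : K) (P : GL (Fin 3) K) (Ha : Matrix (Fin 2) (Fin 2) K) (Hb : Matrix (Fin 1) (Fin 1) K),
      a ≠ b ∧ σ a * a = 1 ∧ σ b * b = 1 ∧
      (((P : Matrix (Fin 3) (Fin 3) K)).map σ)ᵀ * H * (P : Matrix (Fin 3) (Fin 3) K) = finSum 2 1 Ha Hb ∧
      ((γ : GL (Fin 3) K) : Matrix (Fin 3) (Fin 3) K) * (P : Matrix (Fin 3) (Fin 3) K) =
        (P : Matrix (Fin 3) (Fin 3) K) * finSum 2 1 (a • (1 : Matrix (Fin 2) (Fin 2) K)) (b • (1 : Matrix (Fin 1) (Fin 1) K)) ∧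
      (Ha.map σ)ᵀ = Ha ∧ (Hb.map σ)ᵀ = Hb ∧ Ha.det ≠ 0 ∧ Hb.det ≠ 0 := by
  obtain ⟨α, β, hαβ, hγ, hα, hβ⟩ :=
    exists_eigenpair_of_isSemisimple_of_not_separable ((γ : GL (Fin 3) K) : Matrix (Fin 3) (Fin 3) K) hss
      (fun h => hnreg ((isRegularElt_iff _).2 h)) hnsc
  obtain ⟨a, b, P, Ha, Hb, hab, haa, hbb, hG, hγP, hHa, hHb, hda, hdb⟩ :=
    exists_singular_frame σ hσ H hH hdet γ hαβ hγ hα hβ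
  refine ⟨a, b, P, Ha, Hb, ?_, haa, hbb, hG, hγP, hHa, hHb, hda, hdb⟩
  rcases hab with ⟨rfl, rfl⟩ | ⟨rfl, rfl⟩
  · exact hαβ
  · exact Ne.symm hαβ

/-- For an ANISOTROPIC `H` every element of `U_σ(H)(K)` is semisimple (★ `isSemisimpleElt_of_anisotropic`), so the frame exists for every
NON-REGULAR, NON-SCALAR `γ` — the singular classes of the anisotropic inner form `G′`. [cite: Rogawski1990, §3.8 Prop. 3.8.1 p. 27] -/
theorem exists_singular_frame_of_anisotropic (hσ : ∀ x, σ (σ x) = x) (H : Matrix (Fin 3) (Fin 3) K) (hH : (H.map σ)ᵀ = H)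
    (hdet : H.det ≠ 0)
    (hanis : ∀ x : Fin 3 → K, hermForm σ H x x = 0 → x = 0)
    (γ : unitaryGroup σ H) (hnreg : ¬ IsRegularElt (γ : GL (Fin 3) K))
    (hnsc : ∀ ζ : K, ((γ : GL (Fin 3) K) : Matrix (Fin 3) (Fin 3) K) ≠ ζ • 1) :
    ∃ (a b : K) (P : GL (Fin 3) K) (Ha : Matrix (Fin 2) (Fin 2) K) (Hb : Matrix (Fin 1) (Fin 1) K),
      a ≠ b ∧ σ a * a = 1 ∧ σ b * b = 1 ∧
      (((P : Matrix (Fin 3) (Fin 3) K)).map σ)ᵀ * H * (P : Matrix (Fin 3) (Fin 3) K) = finSum 2 1 Ha Hb ∧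
      ((γ : GL (Fin 3) K) : Matrix (Fin 3) (Fin 3) K) * (P : Matrix (Fin 3) (Fin 3) K) =
        (P : Matrix (Fin 3) (Fin 3) K) * finSum 2 1 (a • (1 : Matrix (Fin 2) (Fin 2) K)) (b • (1 : Matrix (Fin 1) (Fin 1) K)) ∧
      (Ha.map σ)ᵀ = Ha ∧ (Hb.map σ)ᵀ = Hb ∧ Ha.det ≠ 0 ∧ Hb.det ≠ 0 :=
  exists_singular_frame_of_isSemisimpleElt σ hσ H hH hdet γ (isSemisimpleElt_of_anisotropic σ H hanis γ) hnreg hnsc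

end Unitary

end Literature.NumberTheory.Rogawski1990
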